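import Summits.Langlands.Langlands.Theses.CoreAdequacySplit
import Summits.Langlands.Langlands.Theorems.CoreAdequacySplitKernel
import Summits.Langlands.Langlands.Theorems.LieDefectSplit
import Literature.NumberTheory.GaloisRepresentations.AdequateOfCoprimeOrder

/-!
# RSL `CoreAdequacySplit.NoAdequateLayerLifting` (stmt-Langlands-27954), line `birth`, stub 3/3 `stub_coprimeTableLifting` — STRUCTURAL HELPERS, part 1

The TABLE stub of the birth skeleton (`Cruxes/NoAdequateLayerLifting/Lines/birth.lean`) is RSL restricted to the rows `ℓ ∤ n`, `(n, ℓ) ≠ (2, 3)` of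
the residual table (small prime `ℓ < 2(n+1)`, cyclotomically irreducible, NO Thorne-adequate layer above the perfect core, solvably irreducible,
absolutely lone).  It is an automorphy-lifting statement over an ARBITRARY number field with the Taylor–Wiles image hypothesis negated on every
solvable layer — a declared residual (no theorem in print; Langlands-implied).  This file lands the def-free STRUCTURE of the stub:

* §1 reductions BY NAME to the landed dossier: the stub follows from RSL itself (`…_of_noAdequateLayerLifting`, row specialisation), hence from
  the three LieDefect cells LIE ∧ DEG ∧ DSH (`…_of_cells`, via the landed `LieDefect.rsl_of_cells'`) and from the summit (`…_of_langlands`, via the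
  landed `Cert.rsl_of_langlands`);
* §2 the RANK-ONE ROW IS EMPTY (pure group theory, proved): every subgroup of `GL₁(k)` acts absolutely irreducibly on the line, `ad⁰ = 0` in rank
  one, and a perfect group has no additive characters — so the perfect core of any `I ≤ GL₁(k)` is an absolutely irreducible Thorne-adequate layer
  (`solvAdequateBetween_fin_one`); hence `CycIrr ρ → SolvablyAdequateImage ρ` in rank one and the stub's hypotheses `CycIrr ∧ ¬SADQ` are
  contradictory there (`rank_one_row_vacuous`);
* §3 the RANK-TWO ROW IS `ℓ = 5` (arithmetic: `ℓ < 6`, `ℓ ∤ 2`, `ℓ ≠ 3`);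
* §4 the EXACT REMAINING LEMMA LIST: the stub (verbatim signature) is EQUIVALENT to the conjunction of ROW(2,5) — RSL at `n = 2`, `ℓ = 5`
  (projective image `PSL₂(𝔽₅)` by BLGG13 App. A Prop. 6.2.1 / census I-L5g11; the classical `p = 5` exception of Wiles–Kisin) — and ROWS(n ≥ 3)
  — RSL at `3 ≤ n`, `ℓ ∤ n`, `ℓ < 2(n+1)` (Guralnick–Herzig–Tiep exception list for `n < ℓ`, uncatalogued for `ℓ < n`)
  (`stub_coprimeTableLifting_iff_rows`).

Vocabulary = the landed twins `Theorems.CoreAdequacy.{LiftTail, LiftBelow, CycIrr, AdequateCyclotomicImage, SolvablyAdequateImage,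
SolvAdequateBetween, IsPerfectCore, perfectCore}` and `Theorems.BrightMate.{SolvablyReducible, SolvablyMated}` BY NAME (all `Iff.rfl` to the
route texts: `rsl_inline_iff`, `solvred_clause_iff`, `solvm_clause_iff`, `adq_clause_iff`, `sadq_clause_iff`).  No new definition; 0 sorry.
-/


set_option linter.dupNamespace false

namespace Summit.Langlands.Langlands.Theorems.CoreAdequacy.CoprimeTable

open Filter
open scoped MatrixGroups
open Literature.NumberTheory.GaloisRepresentations
open Summit.Langlands.Langlands.Theses

universe u

/-! ## §1 Reductions of the TABLE stub to the landed dossier, by name -/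

section Reductions

/-- **TABLE ⟸ RSL** (row specialisation): the stub `stub_coprimeTableLifting` of the birth skeleton, VERBATIM, follows from the crux
`CoreAdequacySplit.NoAdequateLayerLifting` by forgetting the two row hypotheses `¬ ℓ ∣ n`, `¬ (n = 2 ∧ ℓ = 3)`. -/
theorem stub_coprimeTableLifting_of_noAdequateLayerLifting (h : CoreAdequacySplit.NoAdequateLayerLifting) :
    ∀ (K : Type) [Field K] [NumberField K] (n : ℕ) (hcpt : Literature.NumberTheory.Automorphic.isCompact_glFiniteIntegralLevel n K), 0 < n → (∀ m : ℕ, m < n → ∀ (K : Type) [Field K] [NumberField K] (hcpt : Literature.NumberTheory.Automorphic.isCompact_glFiniteIntegralLevel m K), 0 < m → ∀ (ℓ : ℕ) [Fact ℓ.Prime] (ι : PadicAlgCl ℓ ≃+* ℂ) (ρ : Literature.NumberTheory.GaloisRepresentations.FramedGaloisRep K (PadicAlgCl ℓ) m), ρ.toGaloisRep.IsIrreducible → ((∀ᶠ v : IsDedekindDomain.HeightOneSpectrum (NumberField.RingOfIntegers K) in cofinite, ρ.IsUnramifiedAt v) ∧ ∀ (v : IsDedekindDomain.HeightOneSpectrum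 (NumberField.RingOfIntegers K)) (hv : ((ℓ : ℕ) : NumberField.RingOfIntegers K) ∈ v.asIdeal), (Literature.NumberTheory.PAdicHodge.fontainePstAdicCompletion v ℓ hv).IsDeRhamFramed (ρ.toLocal v)) → (∃ (π : Literature.NumberTheory.Automorphic.CuspidalAutomorphicRepData m K hcpt) (ρ' : Literature.NumberTheory.GaloisRepresentations.FramedGaloisRep K (PadicAlgCl ℓ) m), π.1.IsLAlgebraic ∧ ρ'.toGaloisRep.IsIrreducible ∧ (∀ᶠ v : IsDedekindDomain.HeightOneSpectrum (NumberField.RingOfIntegers K) in cofinite, SatakeFrobCompatibleAt ι π.1 ρ' v) ∧ ∀ᶠ v : IsDedekindDomain.HeightOneSpectrum (NumberField.RingOfIntegers K) in cofinite, ∃ P P' : Polynomial (Valued.v : Valuation (PadicAlgCl ℓ) NNReal).valuationSubring, ρ.HasFrobCharpolyAt v (P.map (Valued.v : Valuation (PadicAlgCl ℓ) NNReal).valuationSubring.subtype) ∧ ρ'.HasFrobCharpolyAt v (P'.map (Valued.v : Valuation (PadicAlgCl ℓ) NNReal).valuationSubring.subtype) ∧ P.map (IsLocalRing.residue (Valued.v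 : Valuation (PadicAlgCl ℓ) NNReal).valuationSubring) = P'.map (IsLocalRing.residue (Valued.v : Valuation (PadicAlgCl ℓ) NNReal).valuationSubring)) → ∃ π : Literature.NumberTheory.Automorphic.CuspidalAutomorphicRepData m K hcpt, π.1.IsLAlgebraic ∧ ∀ᶠ v : IsDedekindDomain.HeightOneSpectrum (NumberField.RingOfIntegers K) in cofinite, SatakeFrobCompatibleAt ι π.1 ρ v) → ∀ (ℓ : ℕ) [Fact ℓ.Prime] (ι : PadicAlgCl ℓ ≃+* ℂ) (ρ : Literature.NumberTheory.GaloisRepresentations.FramedGaloisRep K (PadicAlgCl ℓ) n), ℓ < 2 * (n + 1) → ¬ ℓ ∣ n → ¬ (n = 2 ∧ ℓ = 3) → (ρ.restrictField (CyclotomicField ℓ K)).IsResiduallyAbsIrreducible → ¬ (∃ τ : Field.absoluteGaloisGroup (CyclotomicField ℓ K) →* Matrix.GeneralLinearGroup (Fin n) (Literature.NumberTheory.GaloisRepresentations.padicAlgClResidueField ℓ), (ρ.restrictField (CyclotomicField ℓ K)).IsReductionOf (RingHom.id (Literature.NumberTheory.GaloisRepresentations.padicAlgClResidueField ℓ)) τ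 ∧ Literature.NumberTheory.GaloisRepresentations.IsAbsIrreducible τ ∧ Literature.NumberTheory.GaloisRepresentations.Subgroup.IsThorneAdequate τ.range) → ¬ (∃ τ : Field.absoluteGaloisGroup (CyclotomicField ℓ K) →* Matrix.GeneralLinearGroup (Fin n) (Literature.NumberTheory.GaloisRepresentations.padicAlgClResidueField ℓ), (ρ.restrictField (CyclotomicField ℓ K)).IsReductionOf (RingHom.id (Literature.NumberTheory.GaloisRepresentations.padicAlgClResidueField ℓ)) τ ∧ Literature.NumberTheory.GaloisRepresentations.IsAbsIrreducible τ ∧ ∃ P J : Subgroup (Matrix.GeneralLinearGroup (Fin n) (Literature.NumberTheory.GaloisRepresentations.padicAlgClResidueField ℓ)), (P ≤ τ.range ∧ ⁅P, P⁆ = P ∧ ∀ Q : Subgroup (Matrix.GeneralLinearGroup (Fin n) (Literature.NumberTheory.GaloisRepresentations.padicAlgClResidueField ℓ)), Q ≤ τ.range → ⁅Q, Q⁆ = Q → Q ≤ P) ∧ P ≤ J ∧ J ≤ τ.range ∧ Literature.NumberTheory.GaloisRepresentations.IsAbsIrreducible J.subtype ∧ Literature.NumberTheory.GaloisRepresentations.Subgroup.IsThorneAdequate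 J) → ¬ (∃ (E : Type) (_ : Field E) (_ : NumberField E) (_ : Algebra K E), IsGalois K E ∧ IsSolvable (E ≃ₐ[K] E) ∧ ∃ (m : ℕ) (ϑ : Literature.NumberTheory.GaloisRepresentations.FramedGaloisRep E (PadicAlgCl ℓ) m), m < n ∧ 0 < m ∧ ϑ.toGaloisRep.IsIrreducible ∧ ((∀ᶠ v : IsDedekindDomain.HeightOneSpectrum (NumberField.RingOfIntegers E) in cofinite, ϑ.IsUnramifiedAt v) ∧ ∀ (v : IsDedekindDomain.HeightOneSpectrum (NumberField.RingOfIntegers E)) (hv : ((ℓ : ℕ) : NumberField.RingOfIntegers E) ∈ v.asIdeal), (Literature.NumberTheory.PAdicHodge.fontainePstAdicCompletion v ℓ hv).IsDeRhamFramed (ϑ.toLocal v)) ∧ (∃ (mc : ℕ) (θc : Literature.NumberTheory.GaloisRepresentations.FramedGaloisRep E (PadicAlgCl ℓ) mc), ∀ g : Field.absoluteGaloisGroup E, Literature.NumberTheory.GaloisRepresentations.FramedRep.trace (ρ.restrictField E) g = Literature.NumberTheory.GaloisRepresentations.FramedRep.trace ϑ g + Literature.NumberTheory.GaloisRepresentations.FramedRep.trace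 θc g)) → ¬ ((∃ (S : Finset (IsDedekindDomain.HeightOneSpectrum (NumberField.RingOfIntegers K))) (Q : IsDedekindDomain.HeightOneSpectrum (NumberField.RingOfIntegers K) → Polynomial ℂ) (I : Finset ℤ) (L : Set ℕ) (r : ∀ (ℓ' : ℕ) [Fact ℓ'.Prime], (PadicAlgCl ℓ' ≃+* ℂ) → Literature.NumberTheory.GaloisRepresentations.FramedGaloisRep K (PadicAlgCl ℓ') n), ((∃ E : Subfield ℂ, FiniteDimensional ℚ E ∧ ∀ v : IsDedekindDomain.HeightOneSpectrum (NumberField.RingOfIntegers K), v ∉ S → ∀ i : ℕ, (Q v).coeff i ∈ E) ∧ Literature.NumberTheory.LFunctions.HasDirichletDensity L 1 ∧ ∀ (ℓ' : ℕ) [Fact ℓ'.Prime], ℓ' ∈ L → ∀ ι' : PadicAlgCl ℓ' ≃+* ℂ, (r ℓ' ι').toGaloisRep.IsIrreducible ∧ (∀ᶠ v : IsDedekindDomain.HeightOneSpectrum (NumberField.RingOfIntegers K) in cofinite, (r ℓ' ι').IsUnramifiedAt v) ∧ (∀ v : IsDedekindDomain.HeightOneSpectrum (NumberField.RingOfIntegers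 K), v ∉ S → ((ℓ' : ℕ) : NumberField.RingOfIntegers K) ∉ v.asIdeal → (r ℓ' ι').IsUnramifiedAt v ∧ (r ℓ' ι').HasFrobCharpolyAt v ((Q v).map (ι'.symm : ℂ ≃+* PadicAlgCl ℓ').toRingHom)) ∧ ∀ (v : IsDedekindDomain.HeightOneSpectrum (NumberField.RingOfIntegers K)) (hv : ((ℓ' : ℕ) : NumberField.RingOfIntegers K) ∈ v.asIdeal), (Literature.NumberTheory.PAdicHodge.fontainePstAdicCompletion v ℓ' hv).IsDeRhamFramed ((r ℓ' ι').toLocal v) ∧ (v ∉ S → (Literature.NumberTheory.PAdicHodge.fontainePstAdicCompletion v ℓ' hv).IsCrystallineFramed ((r ℓ' ι').toLocal v) ∧ letI := (Literature.NumberTheory.PAdicHodge.fontainePstAdicCompletion v ℓ' hv).algebra; ∀ τ : v.adicCompletion K →ₐ[ℚ_[ℓ']] PadicAlgCl ℓ', ∀ h ∈ (r ℓ' ι').labelledHodgeTateWeightsAt v (Literature.NumberTheory.PAdicHodge.fontainePstAdicCompletion v ℓ' hv).algebra (Literature.NumberTheory.PAdicHodge.fontainePstAdicCompletion v ℓ'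 hv).𝔅 τ.toRingHom, h ∈ I)) ∧ ∀ v : IsDedekindDomain.HeightOneSpectrum (NumberField.RingOfIntegers K), v ∉ S → ((ℓ : ℕ) : NumberField.RingOfIntegers K) ∉ v.asIdeal → ρ.IsUnramifiedAt v ∧ ρ.HasFrobCharpolyAt v ((Q v).map (ι.symm : ℂ ≃+* PadicAlgCl ℓ).toRingHom)) ∨ ∃ (N : Type) (_ : Field N) (_ : NumberField N) (_ : Algebra K N) (M : Type) (_ : Field M) (_ : NumberField M) (_ : Algebra K M) (_ : Algebra M N) (_ : IsScalarTower K M N), IsGalois K N ∧ IsSolvable (N ≃ₐ[K] N) ∧ (ρ.restrictField M).toGaloisRep.IsIrreducible ∧ ∃ (S : Finset (IsDedekindDomain.HeightOneSpectrum (NumberField.RingOfIntegers M))) (Q : IsDedekindDomain.HeightOneSpectrum (NumberField.RingOfIntegers M) → Polynomial ℂ) (I : Finset ℤ) (L : Set ℕ) (r : ∀ (ℓ' : ℕ) [Fact ℓ'.Prime], (PadicAlgCl ℓ' ≃+* ℂ) → Literature.NumberTheory.GaloisRepresentations.FramedGaloisRep M (PadicAlgCl ℓ') n), ((∃ E : Subfield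 ℂ, FiniteDimensional ℚ E ∧ ∀ v : IsDedekindDomain.HeightOneSpectrum (NumberField.RingOfIntegers M), v ∉ S → ∀ i : ℕ, (Q v).coeff i ∈ E) ∧ Literature.NumberTheory.LFunctions.HasDirichletDensity L 1 ∧ ∀ (ℓ' : ℕ) [Fact ℓ'.Prime], ℓ' ∈ L → ∀ ι' : PadicAlgCl ℓ' ≃+* ℂ, (r ℓ' ι').toGaloisRep.IsIrreducible ∧ (∀ᶠ v : IsDedekindDomain.HeightOneSpectrum (NumberField.RingOfIntegers M) in cofinite, (r ℓ' ι').IsUnramifiedAt v) ∧ (∀ v : IsDedekindDomain.HeightOneSpectrum (NumberField.RingOfIntegers M), v ∉ S → ((ℓ' : ℕ) : NumberField.RingOfIntegers M) ∉ v.asIdeal → (r ℓ' ι').IsUnramifiedAt v ∧ (r ℓ' ι').HasFrobCharpolyAt v ((Q v).map (ι'.symm : ℂ ≃+* PadicAlgCl ℓ').toRingHom)) ∧ ∀ (v : IsDedekindDomain.HeightOneSpectrum (NumberField.RingOfIntegers M)) (hv : ((ℓ' : ℕ) : NumberField.RingOfIntegers M) ∈ v.asIdeal), (Literature.NumberTheory.PAdicHodge.fontainePstAdicCompletion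 v ℓ' hv).IsDeRhamFramed ((r ℓ' ι').toLocal v) ∧ (v ∉ S → (Literature.NumberTheory.PAdicHodge.fontainePstAdicCompletion v ℓ' hv).IsCrystallineFramed ((r ℓ' ι').toLocal v) ∧ letI := (Literature.NumberTheory.PAdicHodge.fontainePstAdicCompletion v ℓ' hv).algebra; ∀ τ : v.adicCompletion M →ₐ[ℚ_[ℓ']] PadicAlgCl ℓ', ∀ h ∈ (r ℓ' ι').labelledHodgeTateWeightsAt v (Literature.NumberTheory.PAdicHodge.fontainePstAdicCompletion v ℓ' hv).algebra (Literature.NumberTheory.PAdicHodge.fontainePstAdicCompletion v ℓ' hv).𝔅 τ.toRingHom, h ∈ I)) ∧ ∀ v : IsDedekindDomain.HeightOneSpectrum (NumberField.RingOfIntegers M), v ∉ S → ((ℓ : ℕ) : NumberField.RingOfIntegers M) ∉ v.asIdeal → (ρ.restrictField M).IsUnramifiedAt v ∧ (ρ.restrictField M).HasFrobCharpolyAt v ((Q v).map (ι.symm : ℂ ≃+* PadicAlgCl ℓ).toRingHom)) → ρ.toGaloisRep.IsIrreducible → ((∀ᶠ v : IsDedekindDomain.HeightOneSpectrum (NumberField.RingOfIntegers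 K) in cofinite, ρ.IsUnramifiedAt v) ∧ ∀ (v : IsDedekindDomain.HeightOneSpectrum (NumberField.RingOfIntegers K)) (hv : ((ℓ : ℕ) : NumberField.RingOfIntegers K) ∈ v.asIdeal), (Literature.NumberTheory.PAdicHodge.fontainePstAdicCompletion v ℓ hv).IsDeRhamFramed (ρ.toLocal v)) → (∃ (π : Literature.NumberTheory.Automorphic.CuspidalAutomorphicRepData n K hcpt) (ρ' : Literature.NumberTheory.GaloisRepresentations.FramedGaloisRep K (PadicAlgCl ℓ) n), π.1.IsLAlgebraic ∧ ρ'.toGaloisRep.IsIrreducible ∧ (∀ᶠ v : IsDedekindDomain.HeightOneSpectrum (NumberField.RingOfIntegers K) in cofinite, SatakeFrobCompatibleAt ι π.1 ρ' v) ∧ ∀ᶠ v : IsDedekindDomain.HeightOneSpectrum (NumberField.RingOfIntegers K) in cofinite, ∃ P P' : Polynomial (Valued.v : Valuation (PadicAlgCl ℓ) NNReal).valuationSubring, ρ.HasFrobCharpolyAt v (P.map (Valued.v : Valuation (PadicAlgCl ℓ) NNReal).valuationSubring.subtype) ∧ ρ'.HasFrobCharpolyAt v (P'.map (Valued.v : Valuation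 (PadicAlgCl ℓ) NNReal).valuationSubring.subtype) ∧ P.map (IsLocalRing.residue (Valued.v : Valuation (PadicAlgCl ℓ) NNReal).valuationSubring) = P'.map (IsLocalRing.residue (Valued.v : Valuation (PadicAlgCl ℓ) NNReal).valuationSubring)) → ∃ π : Literature.NumberTheory.Automorphic.CuspidalAutomorphicRepData n K hcpt, π.1.IsLAlgebraic ∧ ∀ᶠ v : IsDedekindDomain.HeightOneSpectrum (NumberField.RingOfIntegers K) in cofinite, SatakeFrobCompatibleAt ι π.1 ρ v :=
  fun K _ _ n hcpt hn ih ℓ _ ι ρ hlt _ _ => h K n hcpt hn ih ℓ ι ρ hlt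

/-- **TABLE ⟸ LIE ∧ DEG ∧ DSH**: the stub follows from the three cells of the child route LieDefectSplit (landed kernel `LieDefect.rsl_of_cells'`),
stated on the structured twin vocabulary (definitionally the verbatim text: `rsl_inline_iff`, `solvred_clause_iff`, `solvm_clause_iff`). -/
theorem stub_coprimeTableLifting_of_cells (hL : LieDefect.LieObstructedLifting) (hD : LieDefect.DegenerateLayerLifting)
    (hB : LieDefect.DescentShadowLifting) :
    ∀ (K : Type) [Field K] [NumberField K] (n : ℕ) (hcpt : Literature.NumberTheory.Automorphic.isCompact_glFiniteIntegralLevel n K), 0 < n →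
      LiftBelow n → ∀ (ℓ : ℕ) [Fact ℓ.Prime] (ι : PadicAlgCl ℓ ≃+* ℂ) (ρ : FramedGaloisRep K (PadicAlgCl ℓ) n),
        ℓ < 2 * (n + 1) → ¬ ℓ ∣ n → ¬ (n = 2 ∧ ℓ = 3) → CycIrr ρ → ¬ AdequateCyclotomicImage ρ → ¬ SolvablyAdequateImage ρ →
          ¬ Theorems.BrightMate.SolvablyReducible ρ → ¬ Theorems.BrightMate.SolvablyMated ι ρ → LiftTail K n hcpt ℓ ι ρ :=
  stub_coprimeTableLifting_of_noAdequateLayerLifting (LieDefect.rsl_of_cells' ⟨hL, hD, hB⟩)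

/-- **Cert: Langlands ⟹ TABLE** (the stub is summit-implied, through the landed `Cert.rsl_of_langlands`; no `¬`-attack on it can succeed
unless the summit is false). -/
theorem stub_coprimeTableLifting_of_langlands (hS : _root_.Langlands) :
    ∀ (K : Type) [Field K] [NumberField K] (n : ℕ) (hcpt : Literature.NumberTheory.Automorphic.isCompact_glFiniteIntegralLevel n K), 0 < n →
      LiftBelow n → ∀ (ℓ : ℕ) [Fact ℓ.Prime] (ι : PadicAlgCl ℓ ≃+* ℂ) (ρ : FramedGaloisRep K (PadicAlgCl ℓ) n),
        ℓ < 2 * (n + 1) → ¬ ℓ ∣ n → ¬ (n = 2 ∧ ℓ = 3) → CycIrr ρ → ¬ AdequateCyclotomicImage ρ → ¬ SolvablyAdequateImage ρ →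
          ¬ Theorems.BrightMate.SolvablyReducible ρ → ¬ Theorems.BrightMate.SolvablyMated ι ρ → LiftTail K n hcpt ℓ ι ρ :=
  stub_coprimeTableLifting_of_noAdequateLayerLifting (Cert.rsl_of_langlands hS)

end Reductions

/-! ## §2 The rank-one row is empty (group theory on `GL₁`) -/

section RankOne

variable {k : Type u} [Field k]

/-- In rank one `ad⁰ = 0`: a trace-zero `1 × 1` matrix vanishes. -/
theorem subsingleton_adZero_fin_one : Subsingleton (adZero (Fin 1) k).toSubmodule := by
  refine ⟨fun M N => Subtype.ext ?_⟩
  have hM := (mem_adZero_toSubmodule_iff M.1).1 M.2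
  have hN := (mem_adZero_toSubmodule_iff N.1).1 N.2
  rw [Matrix.trace_fin_one] at hM hN
  ext i j
  fin_cases i; fin_cases j
  exact hM.trans hN.symm

/-- In rank one clauses (ii)–(iv) of Thorne's Def. 2.3 are automatic (`ad⁰ = 0`): a subgroup `H ≤ GL₁(k)` is Thorne-adequate as soon as
`Hom(H, k) = 0`. -/
theorem isThorneAdequate_fin_one_of_addMonoidHom_eq_zero (H : Subgroup (GL (Fin 1) k)) (hH : ∀ f : Additive H →+ k, f = 0) :
    Subgroup.IsThorneAdequate H := by
  haveI := subsingleton_adZero_fin_one (k := k)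
  refine ⟨hH, ?_, ?_, ?_⟩
  · exact (Submodule.eq_bot_iff _).2 fun M _ => Subsingleton.elim M 0
  · intro f _
    have h0 : f = 0 := funext fun _ => Subsingleton.elim _ _
    rw [h0]
    exact Submodule.zero_mem _
  · intro W hW
    exfalso
    refine hW.1 (Subrepresentation.toSubmodule_injective ?_)
    exact ((Submodule.eq_bot_iff _).2 fun M _ => Subsingleton.elim M 0).trans
      ((Submodule.eq_bot_iff _).2 fun M _ => Subsingleton.elim M 0).symm

/-- Every subgroup of `GL₁(k)` acts absolutely irreducibly on the line `k¹` (Burnside form: its matrices span `M₁(k) = k · 1`; tree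
`span_eq_top_iff_forall_isIrreducible`). -/
theorem isAbsIrreducible_subtype_fin_one (H : Subgroup (GL (Fin 1) k)) : IsAbsIrreducible H.subtype := by
  refine (Literature.RepresentationTheory.Semisimple.span_eq_top_iff_forall_isIrreducible Nat.one_pos H.subtype).1 ?_
  rw [Submodule.eq_top_iff']
  intro M
  have hM : M = M 0 0 • (1 : Matrix (Fin 1) (Fin 1) k) := by
    ext i j
    fin_cases i; fin_cases j
    simp
  rw [hM]
  refine Submodule.smul_mem _ _ (Submodule.subset_span ⟨1, ?_⟩)
  simp

/-- **Rank one: the perfect core is an adequate layer.**  For every `I ≤ GL₁(k)` the perfect core `P` of `I` is absolutely irreducible (rank one)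
and Thorne-adequate (`Hom(P, k) = 0` for a perfect `P`, landed `addMonoidHom_eq_zero_of_perfect`; the other clauses are void), so
`SolvAdequateBetween I` holds with `J = P`. -/
theorem solvAdequateBetween_fin_one (I : Subgroup (GL (Fin 1) k)) : SolvAdequateBetween I :=
  solvAdequateBetween_of_core (isPerfectCore_perfectCore I) (isAbsIrreducible_subtype_fin_one _)
    (isThorneAdequate_fin_one_of_addMonoidHom_eq_zero _ fun f =>
      addMonoidHom_eq_zero_of_perfect (perfectCore I) (isPerfectCore_perfectCore I).2.1 f)

/-- **Rank one: CycIrr ⟹ SADQ.**  A cyclotomically irreducible rank-one `ρ` is solvably adequate (at the same reduction `τ`, layer = perfect core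
of the image). -/
theorem solvablyAdequateImage_of_cycIrr_fin_one {K : Type} [Field K] [NumberField K] {ℓ : ℕ} [Fact ℓ.Prime]
    {ρ : FramedGaloisRep K (PadicAlgCl ℓ) 1} (hc : CycIrr ρ) : SolvablyAdequateImage ρ := by
  obtain ⟨τ, hτ, hirr⟩ := hc
  exact (solvablyAdequateImage_iff ρ).2 ⟨τ, hτ, hirr, solvAdequateBetween_fin_one τ.range⟩

/-- **The rank-one row of the residual table is EMPTY**: at `n = 1` the RSL hypotheses `CycIrr ρ` and `¬ SolvablyAdequateImage ρ` contradict
each other (so every rank-one instance of RSL, of the TABLE stub and of the SLAB stub holds vacuously). -/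
theorem rank_one_row_vacuous {K : Type} [Field K] [NumberField K] {ℓ : ℕ} [Fact ℓ.Prime] {n : ℕ}
    {ρ : FramedGaloisRep K (PadicAlgCl ℓ) n} (hn : n = 1) (hc : CycIrr ρ) (hN : ¬ SolvablyAdequateImage ρ) : False := by
  subst hn
  exact hN (solvablyAdequateImage_of_cycIrr_fin_one hc)

end RankOne

/-! ## §3 The rank-two row of the coprime table is `ℓ = 5` -/

section Arithmetic

/-- The only prime `ℓ < 2·(2+1)` with `ℓ ∤ 2` and `ℓ ≠ 3` is `ℓ = 5`. -/
theorem prime_eq_five_of_rank_two_row {ℓ : ℕ} (hℓ : ℓ.Prime) (hlt : ℓ < 2 * (2 + 1)) (hndvd : ¬ ℓ ∣ 2) (h3 : ¬ (2 = 2 ∧ ℓ = 3)) :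
    ℓ = 5 := by
  have h6 : ℓ < 6 := hlt
  interval_cases ℓ <;> simp_all (config := {decide := true})

/-- Row trichotomy of a positive rank: `n = 1 ∨ n = 2 ∨ 3 ≤ n`. -/
theorem rank_trichotomy {n : ℕ} (hn : 0 < n) : n = 1 ∨ n = 2 ∨ 3 ≤ n := by omega

end Arithmetic

/-! ## §4 The exact remaining lemma list: TABLE ⟺ ROW(2,5) ∧ ROWS(n ≥ 3) -/

section Rows

/-- **The TABLE stub, VERBATIM, is equivalent to the conjunction of its two populated rows**:
ROW(2,5) — RSL at rank `2` and `ℓ = 5` (by BLGG13 App. A Prop. 6.2.1 and the census I-L5g11 the image over `K(ζ₅)` is then projectively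
`PSL₂(𝔽₅)`; the `p = 5` exception of Wiles/Kisin, open over a general number field), and
ROWS(n ≥ 3) — RSL at `3 ≤ n`, `ℓ ∤ n`, `ℓ < 2(n+1)` (for `n < ℓ` the Guralnick–Herzig–Tiep exception list, for `ℓ < n` uncatalogued).
The rank-one row is discharged by §2 and the rank-two arithmetic by §3; nothing else is re-typed. -/
theorem stub_coprimeTableLifting_iff_rows :
    (∀ (K : Type) [Field K] [NumberField K] (n : ℕ) (hcpt : Literature.NumberTheory.Automorphic.isCompact_glFiniteIntegralLevel n K), 0 < n → (∀ m : ℕ, m < n → ∀ (K : Type) [Field K] [NumberField K] (hcpt : Literature.NumberTheory.Automorphic.isCompact_glFiniteIntegralLevel m K), 0 < m → ∀ (ℓ : ℕ) [Fact ℓ.Prime] (ι : PadicAlgCl ℓ ≃+* ℂ) (ρ : Literature.NumberTheory.GaloisRepresentations.FramedGaloisRep K (PadicAlgCl ℓ) m), ρ.toGaloisRep.IsIrreducible → ((∀ᶠ v : IsDedekindDomain.HeightOneSpectrum (NumberField.RingOfIntegers K) in cofinite, ρ.IsUnramifiedAt v) ∧ ∀ (v : IsDedekindDomain.HeightOneSpectrum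 (NumberField.RingOfIntegers K)) (hv : ((ℓ : ℕ) : NumberField.RingOfIntegers K) ∈ v.asIdeal), (Literature.NumberTheory.PAdicHodge.fontainePstAdicCompletion v ℓ hv).IsDeRhamFramed (ρ.toLocal v)) → (∃ (π : Literature.NumberTheory.Automorphic.CuspidalAutomorphicRepData m K hcpt) (ρ' : Literature.NumberTheory.GaloisRepresentations.FramedGaloisRep K (PadicAlgCl ℓ) m), π.1.IsLAlgebraic ∧ ρ'.toGaloisRep.IsIrreducible ∧ (∀ᶠ v : IsDedekindDomain.HeightOneSpectrum (NumberField.RingOfIntegers K) in cofinite, SatakeFrobCompatibleAt ι π.1 ρ' v) ∧ ∀ᶠ v : IsDedekindDomain.HeightOneSpectrum (NumberField.RingOfIntegers K) in cofinite, ∃ P P' : Polynomial (Valued.v : Valuation (PadicAlgCl ℓ) NNReal).valuationSubring, ρ.HasFrobCharpolyAt v (P.map (Valued.v : Valuation (PadicAlgCl ℓ) NNReal).valuationSubring.subtype) ∧ ρ'.HasFrobCharpolyAt v (P'.map (Valued.v : Valuation (PadicAlgCl ℓ) NNReal).valuationSubring.subtype) ∧ P.map (IsLocalRing.residue (Valued.v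 : Valuation (PadicAlgCl ℓ) NNReal).valuationSubring) = P'.map (IsLocalRing.residue (Valued.v : Valuation (PadicAlgCl ℓ) NNReal).valuationSubring)) → ∃ π : Literature.NumberTheory.Automorphic.CuspidalAutomorphicRepData m K hcpt, π.1.IsLAlgebraic ∧ ∀ᶠ v : IsDedekindDomain.HeightOneSpectrum (NumberField.RingOfIntegers K) in cofinite, SatakeFrobCompatibleAt ι π.1 ρ v) → ∀ (ℓ : ℕ) [Fact ℓ.Prime] (ι : PadicAlgCl ℓ ≃+* ℂ) (ρ : Literature.NumberTheory.GaloisRepresentations.FramedGaloisRep K (PadicAlgCl ℓ) n), ℓ < 2 * (n + 1) → ¬ ℓ ∣ n → ¬ (n = 2 ∧ ℓ = 3) → (ρ.restrictField (CyclotomicField ℓ K)).IsResiduallyAbsIrreducible → ¬ (∃ τ : Field.absoluteGaloisGroup (CyclotomicField ℓ K) →* Matrix.GeneralLinearGroup (Fin n) (Literature.NumberTheory.GaloisRepresentations.padicAlgClResidueField ℓ), (ρ.restrictField (CyclotomicField ℓ K)).IsReductionOf (RingHom.id (Literature.NumberTheory.GaloisRepresentations.padicAlgClResidueField ℓ)) τ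 ∧ Literature.NumberTheory.GaloisRepresentations.IsAbsIrreducible τ ∧ Literature.NumberTheory.GaloisRepresentations.Subgroup.IsThorneAdequate τ.range) → ¬ (∃ τ : Field.absoluteGaloisGroup (CyclotomicField ℓ K) →* Matrix.GeneralLinearGroup (Fin n) (Literature.NumberTheory.GaloisRepresentations.padicAlgClResidueField ℓ), (ρ.restrictField (CyclotomicField ℓ K)).IsReductionOf (RingHom.id (Literature.NumberTheory.GaloisRepresentations.padicAlgClResidueField ℓ)) τ ∧ Literature.NumberTheory.GaloisRepresentations.IsAbsIrreducible τ ∧ ∃ P J : Subgroup (Matrix.GeneralLinearGroup (Fin n) (Literature.NumberTheory.GaloisRepresentations.padicAlgClResidueField ℓ)), (P ≤ τ.range ∧ ⁅P, P⁆ = P ∧ ∀ Q : Subgroup (Matrix.GeneralLinearGroup (Fin n) (Literature.NumberTheory.GaloisRepresentations.padicAlgClResidueField ℓ)), Q ≤ τ.range → ⁅Q, Q⁆ = Q → Q ≤ P) ∧ P ≤ J ∧ J ≤ τ.range ∧ Literature.NumberTheory.GaloisRepresentations.IsAbsIrreducible J.subtype ∧ Literature.NumberTheory.GaloisRepresentations.Subgroup.IsThorneAdequate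 J) → ¬ (∃ (E : Type) (_ : Field E) (_ : NumberField E) (_ : Algebra K E), IsGalois K E ∧ IsSolvable (E ≃ₐ[K] E) ∧ ∃ (m : ℕ) (ϑ : Literature.NumberTheory.GaloisRepresentations.FramedGaloisRep E (PadicAlgCl ℓ) m), m < n ∧ 0 < m ∧ ϑ.toGaloisRep.IsIrreducible ∧ ((∀ᶠ v : IsDedekindDomain.HeightOneSpectrum (NumberField.RingOfIntegers E) in cofinite, ϑ.IsUnramifiedAt v) ∧ ∀ (v : IsDedekindDomain.HeightOneSpectrum (NumberField.RingOfIntegers E)) (hv : ((ℓ : ℕ) : NumberField.RingOfIntegers E) ∈ v.asIdeal), (Literature.NumberTheory.PAdicHodge.fontainePstAdicCompletion v ℓ hv).IsDeRhamFramed (ϑ.toLocal v)) ∧ (∃ (mc : ℕ) (θc : Literature.NumberTheory.GaloisRepresentations.FramedGaloisRep E (PadicAlgCl ℓ) mc), ∀ g : Field.absoluteGaloisGroup E, Literature.NumberTheory.GaloisRepresentations.FramedRep.trace (ρ.restrictField E) g = Literature.NumberTheory.GaloisRepresentations.FramedRep.trace ϑ g + Literature.NumberTheory.GaloisRepresentations.FramedRep.trace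 θc g)) → ¬ ((∃ (S : Finset (IsDedekindDomain.HeightOneSpectrum (NumberField.RingOfIntegers K))) (Q : IsDedekindDomain.HeightOneSpectrum (NumberField.RingOfIntegers K) → Polynomial ℂ) (I : Finset ℤ) (L : Set ℕ) (r : ∀ (ℓ' : ℕ) [Fact ℓ'.Prime], (PadicAlgCl ℓ' ≃+* ℂ) → Literature.NumberTheory.GaloisRepresentations.FramedGaloisRep K (PadicAlgCl ℓ') n), ((∃ E : Subfield ℂ, FiniteDimensional ℚ E ∧ ∀ v : IsDedekindDomain.HeightOneSpectrum (NumberField.RingOfIntegers K), v ∉ S → ∀ i : ℕ, (Q v).coeff i ∈ E) ∧ Literature.NumberTheory.LFunctions.HasDirichletDensity L 1 ∧ ∀ (ℓ' : ℕ) [Fact ℓ'.Prime], ℓ' ∈ L → ∀ ι' : PadicAlgCl ℓ' ≃+* ℂ, (r ℓ' ι').toGaloisRep.IsIrreducible ∧ (∀ᶠ v : IsDedekindDomain.HeightOneSpectrum (NumberField.RingOfIntegers K) in cofinite, (r ℓ' ι').IsUnramifiedAt v) ∧ (∀ v : IsDedekindDomain.HeightOneSpectrum (NumberField.RingOfIntegers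 K), v ∉ S → ((ℓ' : ℕ) : NumberField.RingOfIntegers K) ∉ v.asIdeal → (r ℓ' ι').IsUnramifiedAt v ∧ (r ℓ' ι').HasFrobCharpolyAt v ((Q v).map (ι'.symm : ℂ ≃+* PadicAlgCl ℓ').toRingHom)) ∧ ∀ (v : IsDedekindDomain.HeightOneSpectrum (NumberField.RingOfIntegers K)) (hv : ((ℓ' : ℕ) : NumberField.RingOfIntegers K) ∈ v.asIdeal), (Literature.NumberTheory.PAdicHodge.fontainePstAdicCompletion v ℓ' hv).IsDeRhamFramed ((r ℓ' ι').toLocal v) ∧ (v ∉ S → (Literature.NumberTheory.PAdicHodge.fontainePstAdicCompletion v ℓ' hv).IsCrystallineFramed ((r ℓ' ι').toLocal v) ∧ letI := (Literature.NumberTheory.PAdicHodge.fontainePstAdicCompletion v ℓ' hv).algebra; ∀ τ : v.adicCompletion K →ₐ[ℚ_[ℓ']] PadicAlgCl ℓ', ∀ h ∈ (r ℓ' ι').labelledHodgeTateWeightsAt v (Literature.NumberTheory.PAdicHodge.fontainePstAdicCompletion v ℓ' hv).algebra (Literature.NumberTheory.PAdicHodge.fontainePstAdicCompletion v ℓ'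 hv).𝔅 τ.toRingHom, h ∈ I)) ∧ ∀ v : IsDedekindDomain.HeightOneSpectrum (NumberField.RingOfIntegers K), v ∉ S → ((ℓ : ℕ) : NumberField.RingOfIntegers K) ∉ v.asIdeal → ρ.IsUnramifiedAt v ∧ ρ.HasFrobCharpolyAt v ((Q v).map (ι.symm : ℂ ≃+* PadicAlgCl ℓ).toRingHom)) ∨ ∃ (N : Type) (_ : Field N) (_ : NumberField N) (_ : Algebra K N) (M : Type) (_ : Field M) (_ : NumberField M) (_ : Algebra K M) (_ : Algebra M N) (_ : IsScalarTower K M N), IsGalois K N ∧ IsSolvable (N ≃ₐ[K] N) ∧ (ρ.restrictField M).toGaloisRep.IsIrreducible ∧ ∃ (S : Finset (IsDedekindDomain.HeightOneSpectrum (NumberField.RingOfIntegers M))) (Q : IsDedekindDomain.HeightOneSpectrum (NumberField.RingOfIntegers M) → Polynomial ℂ) (I : Finset ℤ) (L : Set ℕ) (r : ∀ (ℓ' : ℕ) [Fact ℓ'.Prime], (PadicAlgCl ℓ' ≃+* ℂ) → Literature.NumberTheory.GaloisRepresentations.FramedGaloisRep M (PadicAlgCl ℓ') n), ((∃ E : Subfield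 ℂ, FiniteDimensional ℚ E ∧ ∀ v : IsDedekindDomain.HeightOneSpectrum (NumberField.RingOfIntegers M), v ∉ S → ∀ i : ℕ, (Q v).coeff i ∈ E) ∧ Literature.NumberTheory.LFunctions.HasDirichletDensity L 1 ∧ ∀ (ℓ' : ℕ) [Fact ℓ'.Prime], ℓ' ∈ L → ∀ ι' : PadicAlgCl ℓ' ≃+* ℂ, (r ℓ' ι').toGaloisRep.IsIrreducible ∧ (∀ᶠ v : IsDedekindDomain.HeightOneSpectrum (NumberField.RingOfIntegers M) in cofinite, (r ℓ' ι').IsUnramifiedAt v) ∧ (∀ v : IsDedekindDomain.HeightOneSpectrum (NumberField.RingOfIntegers M), v ∉ S → ((ℓ' : ℕ) : NumberField.RingOfIntegers M) ∉ v.asIdeal → (r ℓ' ι').IsUnramifiedAt v ∧ (r ℓ' ι').HasFrobCharpolyAt v ((Q v).map (ι'.symm : ℂ ≃+* PadicAlgCl ℓ').toRingHom)) ∧ ∀ (v : IsDedekindDomain.HeightOneSpectrum (NumberField.RingOfIntegers M)) (hv : ((ℓ' : ℕ) : NumberField.RingOfIntegers M) ∈ v.asIdeal), (Literature.NumberTheory.PAdicHodge.fontainePstAdicCompletion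 v ℓ' hv).IsDeRhamFramed ((r ℓ' ι').toLocal v) ∧ (v ∉ S → (Literature.NumberTheory.PAdicHodge.fontainePstAdicCompletion v ℓ' hv).IsCrystallineFramed ((r ℓ' ι').toLocal v) ∧ letI := (Literature.NumberTheory.PAdicHodge.fontainePstAdicCompletion v ℓ' hv).algebra; ∀ τ : v.adicCompletion M →ₐ[ℚ_[ℓ']] PadicAlgCl ℓ', ∀ h ∈ (r ℓ' ι').labelledHodgeTateWeightsAt v (Literature.NumberTheory.PAdicHodge.fontainePstAdicCompletion v ℓ' hv).algebra (Literature.NumberTheory.PAdicHodge.fontainePstAdicCompletion v ℓ' hv).𝔅 τ.toRingHom, h ∈ I)) ∧ ∀ v : IsDedekindDomain.HeightOneSpectrum (NumberField.RingOfIntegers M), v ∉ S → ((ℓ : ℕ) : NumberField.RingOfIntegers M) ∉ v.asIdeal → (ρ.restrictField M).IsUnramifiedAt v ∧ (ρ.restrictField M).HasFrobCharpolyAt v ((Q v).map (ι.symm : ℂ ≃+* PadicAlgCl ℓ).toRingHom)) → ρ.toGaloisRep.IsIrreducible → ((∀ᶠ v : IsDedekindDomain.HeightOneSpectrum (NumberField.RingOfIntegers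 K) in cofinite, ρ.IsUnramifiedAt v) ∧ ∀ (v : IsDedekindDomain.HeightOneSpectrum (NumberField.RingOfIntegers K)) (hv : ((ℓ : ℕ) : NumberField.RingOfIntegers K) ∈ v.asIdeal), (Literature.NumberTheory.PAdicHodge.fontainePstAdicCompletion v ℓ hv).IsDeRhamFramed (ρ.toLocal v)) → (∃ (π : Literature.NumberTheory.Automorphic.CuspidalAutomorphicRepData n K hcpt) (ρ' : Literature.NumberTheory.GaloisRepresentations.FramedGaloisRep K (PadicAlgCl ℓ) n), π.1.IsLAlgebraic ∧ ρ'.toGaloisRep.IsIrreducible ∧ (∀ᶠ v : IsDedekindDomain.HeightOneSpectrum (NumberField.RingOfIntegers K) in cofinite, SatakeFrobCompatibleAt ι π.1 ρ' v) ∧ ∀ᶠ v : IsDedekindDomain.HeightOneSpectrum (NumberField.RingOfIntegers K) in cofinite, ∃ P P' : Polynomial (Valued.v : Valuation (PadicAlgCl ℓ) NNReal).valuationSubring, ρ.HasFrobCharpolyAt v (P.map (Valued.v : Valuation (PadicAlgCl ℓ) NNReal).valuationSubring.subtype) ∧ ρ'.HasFrobCharpolyAt v (P'.map (Valued.v : Valuation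 (PadicAlgCl ℓ) NNReal).valuationSubring.subtype) ∧ P.map (IsLocalRing.residue (Valued.v : Valuation (PadicAlgCl ℓ) NNReal).valuationSubring) = P'.map (IsLocalRing.residue (Valued.v : Valuation (PadicAlgCl ℓ) NNReal).valuationSubring)) → ∃ π : Literature.NumberTheory.Automorphic.CuspidalAutomorphicRepData n K hcpt, π.1.IsLAlgebraic ∧ ∀ᶠ v : IsDedekindDomain.HeightOneSpectrum (NumberField.RingOfIntegers K) in cofinite, SatakeFrobCompatibleAt ι π.1 ρ v) ↔
    ((∀ (K : Type) [Field K] [NumberField K] (n : ℕ) (hcpt : Literature.NumberTheory.Automorphic.isCompact_glFiniteIntegralLevel n K), 0 < n →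
      LiftBelow n → ∀ (ℓ : ℕ) [Fact ℓ.Prime] (ι : PadicAlgCl ℓ ≃+* ℂ) (ρ : FramedGaloisRep K (PadicAlgCl ℓ) n),
        n = 2 → ℓ = 5 → CycIrr ρ → ¬ AdequateCyclotomicImage ρ → ¬ SolvablyAdequateImage ρ →
          ¬ Theorems.BrightMate.SolvablyReducible ρ → ¬ Theorems.BrightMate.SolvablyMated ι ρ → LiftTail K n hcpt ℓ ι ρ) ∧
    (∀ (K : Type) [Field K] [NumberField K] (n : ℕ) (hcpt : Literature.NumberTheory.Automorphic.isCompact_glFiniteIntegralLevel n K), 0 < n →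
      LiftBelow n → ∀ (ℓ : ℕ) [Fact ℓ.Prime] (ι : PadicAlgCl ℓ ≃+* ℂ) (ρ : FramedGaloisRep K (PadicAlgCl ℓ) n),
        3 ≤ n → ℓ < 2 * (n + 1) → ¬ ℓ ∣ n → CycIrr ρ → ¬ AdequateCyclotomicImage ρ → ¬ SolvablyAdequateImage ρ →
          ¬ Theorems.BrightMate.SolvablyReducible ρ → ¬ Theorems.BrightMate.SolvablyMated ι ρ → LiftTail K n hcpt ℓ ι ρ)) := by
  constructor
  · intro h
    refine ⟨?_, ?_⟩
    · intro K _ _ n hcpt hn ih ℓ _ ι ρ h2 h5 hc hA hN hsr hsm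
      subst h2
      subst h5
      exact h K 2 hcpt hn ih 5 ι ρ (by norm_num) (by norm_num) (by norm_num) hc hA hN hsr hsm
    · intro K _ _ n hcpt hn ih ℓ _ ι ρ h3 hlt hndvd hc hA hN hsr hsm
      exact h K n hcpt hn ih ℓ ι ρ hlt hndvd (fun h23 => by omega) hc hA hN hsr hsm
  · rintro ⟨h25, h3⟩ K _ _ n hcpt hn ih ℓ hℓ ι ρ hlt hndvd h23 hc hA hN hsr hsm
    rcases rank_trichotomy hn with h1 | h2 | hge
    · exact (rank_one_row_vacuous h1 hc hN).elim
    · subst h2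
      have h5 : ℓ = 5 := prime_eq_five_of_rank_two_row hℓ.out hlt hndvd h23
      exact h25 K 2 hcpt hn ih ℓ ι ρ rfl h5 hc hA hN hsr hsm
    · exact h3 K n hcpt hn ih ℓ ι ρ hge hlt hndvd hc hA hN hsr hsm

end Rows

end Summit.Langlands.Langlands.Theorems.CoreAdequacy.CoprimeTable
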